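import Mathlib.Algebra.QuadraticAlgebra.Basic
import Mathlib.LinearAlgebra.Span.Basic
import Mathlib.Tactic.Ring
import Mathlib.Tactic.Linarith
import Mathlib.Tactic.Module
import HarnessLib

/-!
# Venture HSemireg — kinds of antilinear involutions on `ℤ[ω]`-lattices: `πL ⊂ ℤ[ω]·L^ψ ⊂ L`
# (ENGINE-W PROBE5 §37, THEOREM 37-A (i) and the binary COROLLARY's entry test) — kernel algebra

HONEST FRAMING. Lean index of the computation cell `pub-hsemireg`, widening group ENGINE-W (code A, seat `engine-w-1`,
gen 16). MODULE ALGEBRA ONLY: a commutative ring with an involution `σ`, a module `M` and a `σ`-semilinear involution `ψ`;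
then the instance `ℤ[ω] = QuadraticAlgebra ℤ (−1) (−1)` (`ω² = −1 − ω`, `σ = star`, the cell's model of
`OrlovIsometryGroupCMQuadratic.lean`). No lattice class, no hermitian form, no abelian variety, sheaf, `Ext` group or
semiregularity map is constructed; nothing here says that HC, HC_CM or HC_AV holds. Theorems only (0 `def`, 0 named fact,
0 `sorry`).

SOURCE (the cell's own result): `widen/ENGINE-W/out/probe5/PROBE5-STIZ-A.md` §37 (v4.3, 2026-08-24T11:18Z; file of record
v4.9k `d984e355a7a98c81`) (1) **THEOREM 37-A (kinds of antilinear structures)**: «Let `L` be a free `O_K`-module of rank `n`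
and `ψ` a `c`-semilinear involution of `L` (`ψ(αx) = ᾱψx`, `ψ² = 1`); `R := L^ψ`. Then (i) `R ≅ ℤⁿ`, `O_K R = R ⊕ ωR`, and
`πL ⊂ O_K R ⊂ L`, so `k(ψ) := dim_{𝔽₃} L∕O_K R ∈ {0, …, n}` («kind»; index `3^k`); (ii) `(L, ψ) ≅ (L′, ψ′)` ⟺ `n = n′` and
`k = k′` …; (iii) `k(−ψ) = n − k(ψ)`. PROOF. (i) `x + ψx ∈ R` and `ωx + ψ(ωx) = ωx + ω̄ψx ∈ R`, and
`(x + ψx) − ω̄·(ωx + ω̄ψx) = (1 − ω)ψx = π·ψx` …» and the COROLLARY (binary hermitian lattices): «`k = 1` (SECOND kind):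
`H ≅ [[a, s√−3],[−s√−3, c]]` (`D₁HD₁ = H̄ ⟺ q̄ = −q ⟺ q ∈ ℤ√−3`)»; one-page card `SYMMETRY-HECKE-CARD-A.md` §A. Tier at
source: hand ×1 (A), reads invited. What the kernel holds:

* §1 (any commutative ring `O`, ring involution `σ`, `O`-module `M`, `σ`-semilinear `ψ` with `ψ ∘ ψ = id`):
  `add_map_mem_fixed` (`x + ψx` is `ψ`-fixed), **`sub_smul_mem_span_fixed`**: `(a − σa)·x ∈ O·M^ψ` for EVERY `a ∈ O`,
  `x ∈ M` — the one-line mechanism of 37-A (i) («`(a·x + ψ(a·x)) − σa·(x + ψx) = (a − σa)·x`»);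
  `smul_fixed_mem_antifixed`: `(a − σa)·r ∈ M^{−ψ}` for `r ∈ M^ψ` (the mechanism of (iii)).
* §2 (`O = ℤ[ω]`): `omega_sub_star_omega` (`ω − ω̄ = 1 + 2ω = √−3`), `sqrtNegThree_sq` (`(1 + 2ω)² = −3`),
  `pi_eq` (`π = 1 − ω = ω̄·(ω − ω̄)`), `pi_eq_neg_omega_mul_star_pi` (`π = −ω·π̄`, the unit ratio `π∕π̄ = −ω` used in (ii));
  **`pi_smul_mem_span_fixed`**: `π·x ∈ ℤ[ω]·M^ψ` for every `x` — i.e. **`πL ⊂ O_K R ⊂ L`**; `three_smul_mem_span_fixed`: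
  `3·x ∈ ℤ[ω]·M^ψ` (so `L∕O_K R` is an `𝔽₃`-space: the «kind» is well defined); **`mem_span_fixed_iff`**:
  `ℤ[ω]·M^ψ = M^ψ + ω·M^ψ` exactly (the sum in «`O_K R = R ⊕ ωR`»); `fixed_inter_omega_fixed` (`r = ω·r′` with
  `r, r′ ∈ M^ψ` forces `(ω − ω̄)·r′ = 0`, hence `r′ = r = 0` when `M` has no `√−3`-torsion: `R ∩ ωR = 0`, the directness).
* §3 (the binary COROLLARY's entry tests, arithmetic in `ℤ[ω]`): `star_eq_self_iff` (`q̄ = q ⟺ q ∈ ℤ`: FIRST kind ↔ real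
  off-diagonal entry) and **`star_eq_neg_iff`** (`q̄ = −q ⟺ q = x·(1 + 2ω) = x√−3`, `x ∈ ℤ`: SECOND kind ↔ off-diagonal entry
  in `ℤ√−3`).
WHAT IS NOT HERE: freeness∕rank statements (`R ≅ ℤⁿ`), the classification (ii) by `k` (elementary divisors over `ℤ` +
`GL_n(ℤ) ↠ GL_n(𝔽₃) ⊇ SL_n`), and (iii)'s dimension count — recorded in PROBE5 §37, not kernel-checked here.
-/

namespace Summit.Ventures.HSemireg.AntilinearKinds

/-! ## §1 A `σ`-semilinear involution on a module: `(a − σa)·M ⊆ O·M^ψ` -/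

section General

variable {O : Type*} [CommRing O] {M : Type*} [AddCommGroup M] [Module O M]
variable {σ : O →+* O} (ψ : M →ₛₗ[σ] M)

/-- `x + ψx` is `ψ`-fixed when `ψ ∘ ψ = id` («`x + ψx ∈ R`»). [kernel] -/
theorem add_map_mem_fixed (hψ : ∀ x, ψ (ψ x) = x) (x : M) : ψ (x + ψ x) = x + ψ x := by
  rw [map_add, hψ, add_comm]

/-- `a·x + ψ(a·x) = a·x + σa·ψx` is `ψ`-fixed when `σ ∘ σ = id` and `ψ ∘ ψ = id` («`ωx + ψ(ωx) = ωx + ω̄ψx ∈ R`»). [kernel] -/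
theorem smul_add_map_smul_mem_fixed (hσ : ∀ a, σ (σ a) = a) (hψ : ∀ x, ψ (ψ x) = x) (a : O) (x : M) :
    ψ (a • x + σ a • ψ x) = a • x + σ a • ψ x := by
  rw [map_add, LinearMap.map_smulₛₗ, LinearMap.map_smulₛₗ, hσ, hψ, add_comm]

/-- **THE MECHANISM OF THEOREM 37-A (i).** For a `σ`-semilinear involution `ψ` (`σ ∘ σ = id`, `ψ ∘ ψ = id`) and ANY `a ∈ O`,
`x ∈ M`: `(a − σa)·x ∈ O·M^ψ`, because `(a·x + σa·ψx) − σa·(x + ψx) = (a − σa)·x` is a difference of an element of `M^ψ`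
and an `O`-multiple of one. [kernel] -/
theorem sub_smul_mem_span_fixed (hσ : ∀ a, σ (σ a) = a) (hψ : ∀ x, ψ (ψ x) = x) (a : O) (x : M) :
    (a - σ a) • x ∈ Submodule.span O {y : M | ψ y = y} := by
  have h1 : a • x + σ a • ψ x ∈ Submodule.span O {y : M | ψ y = y} :=
    Submodule.subset_span (smul_add_map_smul_mem_fixed ψ hσ hψ a x)
  have h2 : σ a • (x + ψ x) ∈ Submodule.span O {y : M | ψ y = y} :=
    Submodule.smul_mem _ _ (Submodule.subset_span (add_map_mem_fixed ψ hψ x))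
  have h3 : (a - σ a) • x = (a • x + σ a • ψ x) - σ a • (x + ψ x) := by
    rw [sub_smul, smul_add]
    abel
  rw [h3]
  exact Submodule.sub_mem _ h1 h2

/-- The mechanism of 37-A (iii): `ψ` NEGATES `(a − σa)·r` for `r ∈ M^ψ` («`L^{−ψ} ⊇ √−3·L^ψ`»). [kernel] -/
theorem smul_fixed_mem_antifixed (hσ : ∀ a, σ (σ a) = a) (a : O) {r : M} (hr : ψ r = r) :
    ψ ((a - σ a) • r) = -((a - σ a) • r) := by
  rw [LinearMap.map_smulₛₗ, hr, map_sub, hσ, ← neg_smul, neg_sub]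

end General

/-! ## §2 The instance `O = ℤ[ω]` (`ω² = −1 − ω`, `σ = star`): `πL ⊂ ℤ[ω]·L^ψ ⊂ L` -/

section Eisenstein

open QuadraticAlgebra

/-- `ω − ω̄ = 1 + 2ω` (`= √−3`) in `ℤ[ω]`. [kernel] -/
theorem omega_sub_star_omega :
    (ω : QuadraticAlgebra ℤ (-1) (-1)) - star ω = ⟨1, 2⟩ := by
  ext <;> simp [star_mk, omega]

/-- `(1 + 2ω)² = −3`: `1 + 2ω` is a square root of `−3` in `ℤ[ω]`. [kernel] -/
theorem sqrtNegThree_sq : (⟨1, 2⟩ : QuadraticAlgebra ℤ (-1) (-1)) * ⟨1, 2⟩ = -3 := by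
  ext <;> simp

/-- `π := 1 − ω` equals `ω̄·(ω − ω̄)`: `π` and `√−3` are associates (the unit is `ω̄`). [kernel] -/
theorem pi_eq : (1 - ω : QuadraticAlgebra ℤ (-1) (-1)) = star ω * (ω - star ω) := by
  ext <;> simp [star_mk, omega]

/-- `π = −ω·π̄`, i.e. the unit ratio `π ∕ π̄ = −ω` used in 37-A (ii) («`ψ(π⁻¹αr) = π̄⁻¹ᾱr = (π∕π̄)·π⁻¹ᾱr` with `π∕π̄ = −ω`»).
[kernel] -/
theorem pi_eq_neg_omega_mul_star_pi :
    (1 - ω : QuadraticAlgebra ℤ (-1) (-1)) = -ω * star (1 - ω) := by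
  ext <;> simp [star_mk, omega]

variable {M : Type*} [AddCommGroup M] [Module (QuadraticAlgebra ℤ (-1) (-1)) M]
variable (ψ : M →ₛₗ[starRingEnd (QuadraticAlgebra ℤ (-1) (-1))] M)

/-- **THEOREM 37-A (i), kernel form: `πL ⊂ O_K·L^ψ`.** For a `c`-semilinear (`c = star`) involution `ψ` of a
`ℤ[ω]`-module `M` and every `x ∈ M`: `(1 − ω)·x ∈ ℤ[ω]·M^ψ`. (`O_K·M^ψ ⊂ M` is automatic: it is a submodule of `M`.) [kernel] -/
theorem pi_smul_mem_span_fixed (hψ : ∀ x, ψ (ψ x) = x) (x : M) :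
    (1 - ω : QuadraticAlgebra ℤ (-1) (-1)) • x ∈
      Submodule.span (QuadraticAlgebra ℤ (-1) (-1)) {y : M | ψ y = y} := by
  have h := sub_smul_mem_span_fixed ψ (fun a => by simp) hψ ω x
  rw [starRingEnd_apply] at h
  rw [pi_eq, mul_smul]
  exact Submodule.smul_mem _ _ h

/-- `3·x ∈ ℤ[ω]·M^ψ` for every `x`: the quotient `M ∕ ℤ[ω]·M^ψ` is killed by `3` (indeed by `π`), so it is an `𝔽₃`-space and
the «kind» `k(ψ) = dim_{𝔽₃} M ∕ ℤ[ω]·M^ψ` is well defined. [kernel] -/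
theorem three_smul_mem_span_fixed (hψ : ∀ x, ψ (ψ x) = x) (x : M) :
    (3 : QuadraticAlgebra ℤ (-1) (-1)) • x ∈
      Submodule.span (QuadraticAlgebra ℤ (-1) (-1)) {y : M | ψ y = y} := by
  have h := sub_smul_mem_span_fixed ψ (fun a => by simp) hψ ω x
  rw [starRingEnd_apply, omega_sub_star_omega] at h
  have h3 : (3 : QuadraticAlgebra ℤ (-1) (-1)) • x = (-(⟨1, 2⟩ : QuadraticAlgebra ℤ (-1) (-1))) • ((⟨1, 2⟩ :
      QuadraticAlgebra ℤ (-1) (-1)) • x) := by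
    rw [← mul_smul, neg_mul, sqrtNegThree_sq, neg_neg]
  rw [h3]
  exact Submodule.smul_mem _ _ h

/-- Integer scalars (through `ℤ ⊂ ℤ[ω]`) preserve `ψ`-fixed vectors (`star` fixes `ℤ`). [kernel] -/
theorem intCast_smul_fixed (p : ℤ) {r : M} (hr : ψ r = r) :
    ψ ((p : QuadraticAlgebra ℤ (-1) (-1)) • r) = (p : QuadraticAlgebra ℤ (-1) (-1)) • r := by
  rw [LinearMap.map_smulₛₗ, starRingEnd_apply, star_intCast, hr]

/-- **`O_K R = R + ωR`** (the sum in «`O_K R = R ⊕ ωR`»): the `ℤ[ω]`-span of the `ψ`-fixed vectors consists exactly of the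
`r + ω·r′` with `r, r′` `ψ`-fixed (because `ℤ[ω] = ℤ ⊕ ℤω` and `ω² = −1 − ω`). [kernel] -/
theorem mem_span_fixed_iff (x : M) :
    x ∈ Submodule.span (QuadraticAlgebra ℤ (-1) (-1)) {y : M | ψ y = y} ↔
      ∃ r r' : M, ψ r = r ∧ ψ r' = r' ∧ x = r + (ω : QuadraticAlgebra ℤ (-1) (-1)) • r' := by
  constructor
  · intro hx
    induction hx using Submodule.span_induction with
    | mem y hy => exact ⟨y, 0, hy, by simp, by simp⟩
    | zero => exact ⟨0, 0, by simp, by simp, by simp⟩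
    | add y z _ _ ihy ihz =>
      obtain ⟨r₁, r₁', h₁, h₁', rfl⟩ := ihy
      obtain ⟨r₂, r₂', h₂, h₂', rfl⟩ := ihz
      refine ⟨r₁ + r₂, r₁' + r₂', by rw [map_add, h₁, h₂], by rw [map_add, h₁', h₂'], ?_⟩
      rw [smul_add]
      abel
    | smul a y _ ih =>
      obtain ⟨r, r', hr, hr', rfl⟩ := ih
      obtain ⟨p, q⟩ := a
      have ha : (⟨p, q⟩ : QuadraticAlgebra ℤ (-1) (-1))
          = (p : QuadraticAlgebra ℤ (-1) (-1)) + (q : QuadraticAlgebra ℤ (-1) (-1)) * ω := by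
        ext <;> simp [omega, re_intCast, im_intCast]
      have hw : (ω : QuadraticAlgebra ℤ (-1) (-1)) * ω = -1 - ω := by
        ext <;> simp [omega]
      refine ⟨(p : QuadraticAlgebra ℤ (-1) (-1)) • r - (q : QuadraticAlgebra ℤ (-1) (-1)) • r',
        (p : QuadraticAlgebra ℤ (-1) (-1)) • r' + (q : QuadraticAlgebra ℤ (-1) (-1)) • r
          - (q : QuadraticAlgebra ℤ (-1) (-1)) • r', ?_, ?_, ?_⟩
      · rw [map_sub, intCast_smul_fixed ψ p hr, intCast_smul_fixed ψ q hr']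
      · rw [map_sub, map_add, intCast_smul_fixed ψ p hr', intCast_smul_fixed ψ q hr, intCast_smul_fixed ψ q hr']
      · have key : ((q : QuadraticAlgebra ℤ (-1) (-1)) * ω) • ((ω : QuadraticAlgebra ℤ (-1) (-1)) • r')
            = ((q : QuadraticAlgebra ℤ (-1) (-1)) * (-1 - ω)) • r' := by
          rw [← mul_smul, mul_assoc, hw]
        rw [ha, add_smul, smul_add, smul_add, key]
        module
  · rintro ⟨r, r', hr, hr', rfl⟩
    exact Submodule.add_mem _ (Submodule.subset_span hr) (Submodule.smul_mem _ _ (Submodule.subset_span hr'))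

/-- **`R ∩ ωR = 0`** (the directness in «`O_K R = R ⊕ ωR`»): if `r = ω·r′` with `r, r′` both `ψ`-fixed then
`(ω − ω̄)·r′ = 0`; so `r′ = 0` (and `r = 0`) as soon as `M` has no `√−3`-torsion. [kernel] -/
theorem fixed_inter_omega_fixed (r r' : M) (hr : ψ r = r) (hr' : ψ r' = r')
    (h : r = (ω : QuadraticAlgebra ℤ (-1) (-1)) • r') :
    ((ω : QuadraticAlgebra ℤ (-1) (-1)) - star ω) • r' = 0 := by
  have h1 : ψ r = star (ω : QuadraticAlgebra ℤ (-1) (-1)) • r' := by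
    rw [h, LinearMap.map_smulₛₗ, starRingEnd_apply, hr']
  rw [hr, h] at h1
  rw [sub_smul, sub_eq_zero, h1]

/-- The same with the torsion hypothesis discharged: no `√−3`-torsion ⟹ `r′ = 0 ∧ r = 0`. [kernel] -/
theorem fixed_inter_omega_fixed_eq_zero [NoZeroSMulDivisors (QuadraticAlgebra ℤ (-1) (-1)) M]
    (r r' : M) (hr : ψ r = r) (hr' : ψ r' = r') (h : r = (ω : QuadraticAlgebra ℤ (-1) (-1)) • r') :
    r' = 0 ∧ r = 0 := by
  have h0 := fixed_inter_omega_fixed ψ r r' hr hr' h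
  rw [omega_sub_star_omega] at h0
  have hne : (⟨1, 2⟩ : QuadraticAlgebra ℤ (-1) (-1)) ≠ 0 := by
    intro h'; have := congrArg QuadraticAlgebra.re h'; simp at this
  have hr'0 : r' = 0 := (NoZeroSMulDivisors.eq_zero_or_eq_zero_of_smul_eq_zero h0).resolve_left hne
  exact ⟨hr'0, by rw [h, hr'0, smul_zero]⟩

/-- 37-A (iii)'s mechanism in `ℤ[ω]`: `ψ` negates `√−3·r = (1 + 2ω)·r` for `ψ`-fixed `r` («`L^{−ψ} ⊇ √−3·L^ψ`»). [kernel] -/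
theorem sqrtNegThree_smul_fixed_antifixed {r : M} (hr : ψ r = r) :
    ψ ((⟨1, 2⟩ : QuadraticAlgebra ℤ (-1) (-1)) • r) = -((⟨1, 2⟩ : QuadraticAlgebra ℤ (-1) (-1)) • r) := by
  have h := smul_fixed_mem_antifixed ψ (σ := starRingEnd (QuadraticAlgebra ℤ (-1) (-1))) (fun a => by simp) ω hr
  rwa [starRingEnd_apply, omega_sub_star_omega] at h

end Eisenstein

/-! ## §3 The binary COROLLARY's entry tests: which off-diagonal entries are `c`-symmetric ∕ `c`-antisymmetric -/

section Binary

open QuadraticAlgebra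

/-- FIRST kind (`D₀ = 1`, `H̄ = H`): an entry `q ∈ ℤ[ω]` is fixed by `c` iff `q ∈ ℤ` (`q = x + yω`, `q̄ = (x − y) − yω`). [kernel] -/
theorem star_eq_self_iff (q : QuadraticAlgebra ℤ (-1) (-1)) : star q = q ↔ q.im = 0 := by
  constructor
  · intro h
    have := congrArg QuadraticAlgebra.im h
    simp [im_star] at this
    linarith
  · intro h
    ext <;> simp [re_star, im_star, h]

/-- **SECOND kind** (`D₁ = diag(−1, 1)`, `D₁HD₁ = H̄ ⟺ q̄ = −q`): an entry `q = x + yω ∈ ℤ[ω]` satisfies `q̄ = −q` iff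
`y = 2x`, i.e. `q = x·(1 + 2ω) = x√−3 ∈ ℤ√−3` («`q̄ = −q ⟺ q ∈ ℤ√−3`»). [kernel] -/
theorem star_eq_neg_iff (q : QuadraticAlgebra ℤ (-1) (-1)) :
    star q = -q ↔ q = (q.re : ℤ) • (⟨1, 2⟩ : QuadraticAlgebra ℤ (-1) (-1)) := by
  constructor
  · intro h
    have hre := congrArg QuadraticAlgebra.re h
    simp [re_star] at hre
    ext <;> simp
    linarith
  · intro h
    have him : q.im = 2 * q.re := by
      have := congrArg QuadraticAlgebra.im h
      simp only [QuadraticAlgebra.im_smul, smul_eq_mul] at this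
      linarith
    ext <;> simp [re_star, im_star, him]
    ring

end Binary

end Summit.Ventures.HSemireg.AntilinearKinds
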